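import Summits.KontsevichZagierPeriods.KontsevichZagierPeriods.Theses.HurwitzMicroSectors
import Summits.KontsevichZagierPeriods.KontsevichZagierPeriods.Theorems.DilationMove.Negative.LoadBearing
import Literature.NumberTheory.Transcendental.BoxCoordinatePowerMap

/-! drefute scratch: stubs of line `coordpow-api-assembly` (crux DilationMove, stmt-3872).
§1 sanity proofs of both registered stubs; §2 structural refutation channel for one-move
statements; §3 load-bearing analysis (mutations) of `stub_orthantCoordPowMove`; §4 positive
strengthenings (information for the lead). -/

noncomputable section

open Set MvPolynomial MeasureTheory intervalIntegral
open Literature.NumberTheory.Transcendental Literature.ModelTheory.ExponentialFields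
open Summit.KontsevichZagierPeriods.HurwitzMicroSectors.DilationMoveNegative

namespace DrefuteStubs

/-- registered signature of `stub_isSemialgebraicMapOn_coordPow` (verbatim). -/
def Stub1 : Prop :=
  ∀ (n m : ℕ) (σ : Set (Fin n → ℝ)), IsSemialgebraic ℚ σ →
    IsSemialgebraicMapOn ℚ σ (fun x : Fin n → ℝ => BoxIntegral.coordPow m x)

/-- registered signature of `stub_orthantCoordPowMove` (verbatim). -/
def Stub2 : Prop :=
  ∀ (n m : ℕ), 1 ≤ m → ∀ (r r' : KZ.IntegralRep n), r.domain ⊆ {x | ∀ i, 0 < x i} →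
    IsSemialgebraicMapOn ℚ r.domain (fun x : Fin n → ℝ => BoxIntegral.coordPow m x) →
    r'.domain = (fun x : Fin n → ℝ => BoxIntegral.coordPow m x) '' r.domain →
    (∀ x ∈ r.domain, r.integrand x = r'.integrand (BoxIntegral.coordPow m x) * ((m : ℝ) ^ n * ∏ i, x i ^ (m - 1))) →
    KZ.of r - KZ.of r' ∈ KZ.changeOfVariablesRel

/-! ## §1 sanity: both stubs hold as registered -/

theorem stub1_holds : Stub1 := by
  intro n m σ hσ
  refine (isSemialgebraicMapOn_aeval hσ (fun j : Fin n => (X j : MvPolynomial (Fin n) ℚ) ^ m)).congr ?_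
  intro x _
  funext j
  simp [BoxIntegral.coordPow]

theorem stub2_holds : Stub2 := by
  intro n m hm r r' hσ hΦ himg hint
  have hm0 : m ≠ 0 := by omega
  refine ⟨n, r, r', fun x => BoxIntegral.coordPow m x, BoxIntegral.coordPowDeriv m, hΦ,
    fun x _ => BoxIntegral.hasFDerivWithinAt_coordPow m r.domain x,
    (BoxIntegral.injOn_coordPow hm0).mono (fun x hx i => (hσ hx i).le), himg, fun x hx => ?_, rfl⟩
  rw [hint x hx, BoxIntegral.det_coordPowDeriv, abs_of_pos]
  have hm' : (0:ℝ) < m := by exact_mod_cast Nat.pos_of_ne_zero hm0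
  exact mul_pos (pow_pos hm' n) (Finset.prod_pos fun i _ => pow_pos (hσ hx i) _)

/-! ## §2 structural channel: membership of `[r] − [r']` pins the witness pair to `(r, r')` -/

theorem of_sub_of_eq_of_sub_of {X : Type*} {a b c d : X} (hab : a ≠ b)
    (h : FreeAbelianGroup.of a - FreeAbelianGroup.of b = FreeAbelianGroup.of c - FreeAbelianGroup.of d) :
    a = c ∧ b = d := by
  classical
  have h' := congrArg FreeAbelianGroup.toFinsupp h
  simp only [map_sub, FreeAbelianGroup.toFinsupp_of] at h'
  have ha := DFunLike.congr_fun h' a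
  have hb := DFunLike.congr_fun h' b
  simp only [Finsupp.coe_sub, Pi.sub_apply, Finsupp.single_apply, if_true, if_neg hab,
    if_neg (Ne.symm hab)] at ha hb
  by_cases hca : c = a
  · by_cases hdb : d = b
    · exact ⟨hca.symm, hdb.symm⟩
    · have hcb : c ≠ b := fun e => hab (hca.symm.trans e)
      rw [if_neg hcb, if_neg hdb] at hb
      norm_num at hb
  · rw [if_neg hca] at ha
    by_cases hda : d = a
    · rw [if_pos hda] at ha
      norm_num at ha
    · rw [if_neg hda] at ha
      norm_num at ha

theorem covData_of_mem {n : ℕ} {r r' : KZ.IntegralRep n} (hne : r ≠ r')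
    (h : KZ.of r - KZ.of r' ∈ KZ.changeOfVariablesRel) :
    ∃ (Φ : (Fin n → ℝ) → (Fin n → ℝ)) (Φ' : (Fin n → ℝ) → (Fin n → ℝ) →L[ℝ] (Fin n → ℝ)),
      IsSemialgebraicMapOn ℚ r.domain Φ ∧ (∀ x ∈ r.domain, HasFDerivWithinAt Φ (Φ' x) r.domain x) ∧
      InjOn Φ r.domain ∧ r'.domain = Φ '' r.domain ∧
      (∀ x ∈ r.domain, r.integrand x = r'.integrand (Φ x) * |(Φ' x).det|) := by
  obtain ⟨n', a, b, Φ, Φ', h1, h2, h3, h4, h5, hc⟩ := h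
  have hne' : (⟨n, r⟩ : Σ k, KZ.IntegralRep k) ≠ ⟨n, r'⟩ := fun e => hne (by cases e; rfl)
  obtain ⟨e1, e2⟩ := of_sub_of_eq_of_sub_of hne' hc
  cases e1
  cases e2
  exact ⟨Φ, Φ', h1, h2, h3, h4, h5⟩

theorem mem_changeOfVariablesRel_iff_of_ne {n : ℕ} {r r' : KZ.IntegralRep n} (hne : r ≠ r') :
    KZ.of r - KZ.of r' ∈ KZ.changeOfVariablesRel ↔
    ∃ (Φ : (Fin n → ℝ) → (Fin n → ℝ)) (Φ' : (Fin n → ℝ) → (Fin n → ℝ) →L[ℝ] (Fin n → ℝ)),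
      IsSemialgebraicMapOn ℚ r.domain Φ ∧ (∀ x ∈ r.domain, HasFDerivWithinAt Φ (Φ' x) r.domain x) ∧
      InjOn Φ r.domain ∧ r'.domain = Φ '' r.domain ∧
      (∀ x ∈ r.domain, r.integrand x = r'.integrand (Φ x) * |(Φ' x).det|) :=
  ⟨covData_of_mem hne, fun ⟨Φ, Φ', h1, h2, h3, h4, h5⟩ => ⟨n, r, r', Φ, Φ', h1, h2, h3, h4, h5, rfl⟩⟩

/-! ## §3 mutations of `stub_orthantCoordPowMove` -/

/-- the point `{1} ⊆ ℝ¹` is `ℚ`-semialgebraic. -/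
theorem isSemialgebraic_pointOne : IsSemialgebraic ℚ {y : Fin 1 → ℝ | y 0 = 1} := by
  convert isSemialgebraic_setOf_eval_eq_zero (k := ℚ) (R := ℝ) (ι := Fin 1) (X 0 - C 1) using 2 with y
  simp [sub_eq_zero]

/-- `[{1}, 0]` in dimension 1. -/
def pointRep : KZ.IntegralRep 1 where
  domain := {y | y 0 = 1}
  integrand := fun _ => 0
  isSemialgebraic_domain := isSemialgebraic_pointOne
  isSemialgebraicFunOn_integrand :=
    (isSemialgebraicFunOn_aeval isSemialgebraic_pointOne (0 : MvPolynomial (Fin 1) ℚ)).congr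
      (fun x _ => by simp)
  integrableOn := integrableOn_zero

theorem image_coordPow_zero_ibox :
    (fun x : Fin 1 → ℝ => BoxIntegral.coordPow 0 x) '' ibox 1 0 1 = {y : Fin 1 → ℝ | y 0 = 1} := by
  ext y
  simp only [mem_image, mem_setOf_eq]
  constructor
  · rintro ⟨x, -, rfl⟩
    simp [BoxIntegral.coordPow]
  · intro hy
    refine ⟨fun _ => 1 / 2, fun i => ⟨by norm_num, by norm_num⟩, ?_⟩
    funext i
    fin_cases i
    simpa [BoxIntegral.coordPow] using hy.symm

/-- `stub_orthantCoordPowMove` with `1 ≤ m` dropped. -/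
def Stub2WithoutOneLe : Prop :=
  ∀ (n m : ℕ) (r r' : KZ.IntegralRep n), r.domain ⊆ {x | ∀ i, 0 < x i} →
    IsSemialgebraicMapOn ℚ r.domain (fun x : Fin n → ℝ => BoxIntegral.coordPow m x) →
    r'.domain = (fun x : Fin n → ℝ => BoxIntegral.coordPow m x) '' r.domain →
    (∀ x ∈ r.domain, r.integrand x = r'.integrand (BoxIntegral.coordPow m x) * ((m : ℝ) ^ n * ∏ i, x i ^ (m - 1))) →
    KZ.of r - KZ.of r' ∈ KZ.changeOfVariablesRel

/-- `1 ≤ m` is load-bearing: at `m = 0`, `n = 1` the source `[(0,1), 0]` and the target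
`[{1}, 0]` satisfy every remaining hypothesis (factor `0¹·t^(0-1) = 0`, image of the box under the
constant map `coordPow 0 = 1` is the point), both VALUES are `0` (soundness is blind here), but the
structural channel `covData_of_mem` demands an injection of `(0,1)` onto a point. -/
theorem stub2_false_without_oneLe : ¬ Stub2WithoutOneLe := by
  intro h
  have hmem := h 1 0 (monoRep 0 1 0 0) pointRep
    (fun x hx i => by simpa using (hx i).1)
    (stub1_holds 1 0 _ (monoRep 0 1 0 0).isSemialgebraic_domain)
    (by rw [monoRep_domain, image_coordPow_zero_ibox]; rfl)
    (fun x _ => by simp [pointRep])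
  have hne : monoRep 0 1 0 0 ≠ pointRep := by
    intro e
    have hd := congrArg KZ.IntegralRep.domain e
    have hx : (fun _ : Fin 1 => (1 / 2 : ℝ)) ∈ (monoRep 0 1 0 0).domain := fun i => ⟨by norm_num, by norm_num⟩
    rw [hd] at hx
    norm_num [pointRep] at hx
  obtain ⟨Φ, Φ', -, -, hinj, himg, -⟩ := covData_of_mem hne hmem
  have ha : (fun _ : Fin 1 => (1 / 4 : ℝ)) ∈ (monoRep 0 1 0 0).domain := fun i => ⟨by norm_num, by norm_num⟩
  have hb : (fun _ : Fin 1 => (1 / 2 : ℝ)) ∈ (monoRep 0 1 0 0).domain := fun i => ⟨by norm_num, by norm_num⟩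
  have hΦa : Φ (fun _ => 1 / 4) ∈ pointRep.domain := by rw [himg]; exact mem_image_of_mem Φ ha
  have hΦb : Φ (fun _ => 1 / 2) ∈ pointRep.domain := by rw [himg]; exact mem_image_of_mem Φ hb
  have hab : Φ (fun _ => 1 / 4) = Φ (fun _ => 1 / 2) := by
    funext i
    fin_cases i
    exact hΦa.trans hΦb.symm
  have := congr_fun (hinj ha hb hab) 0
  norm_num at this

/-- the half-open box `[0,1) ⊆ ℝ¹` is `ℚ`-semialgebraic. -/
theorem isSemialgebraic_icoBox : IsSemialgebraic ℚ {y : Fin 1 → ℝ | y 0 ∈ Ico (0:ℝ) 1} := by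
  have h := (isSemialgebraic_setOf_eval_le (k := ℚ) (R := ℝ) (ι := Fin 1) (C 0) (X 0)).inter
    (isSemialgebraic_setOf_eval_lt (k := ℚ) (R := ℝ) (ι := Fin 1) (X 0) (C 1))
  have hEq : {y : Fin 1 → ℝ | y 0 ∈ Ico (0:ℝ) 1} =
      {x : Fin 1 → ℝ | aeval x (C 0 : MvPolynomial (Fin 1) ℚ) ≤ aeval x (X 0 : MvPolynomial (Fin 1) ℚ)} ∩
      {x : Fin 1 → ℝ | aeval x (X 0 : MvPolynomial (Fin 1) ℚ) < aeval x (C 1 : MvPolynomial (Fin 1) ℚ)} := by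
    ext y
    simp
  rw [hEq]
  exact h

theorem icoBox_subset_Icc :
    {y : Fin 1 → ℝ | y 0 ∈ Ico (0:ℝ) 1} ⊆ Icc (fun _ => (0:ℝ)) (fun _ => 1) := by
  intro y hy
  refine ⟨fun i => ?_, fun i => ?_⟩ <;> fin_cases i
  · exact hy.1
  · exact hy.2.le

/-- `[[0,1), 1]` in dimension 1. -/
def icoRep : KZ.IntegralRep 1 where
  domain := {y | y 0 ∈ Ico (0:ℝ) 1}
  integrand := fun _ => 1
  isSemialgebraic_domain := isSemialgebraic_icoBox
  isSemialgebraicFunOn_integrand :=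
    (isSemialgebraicFunOn_aeval isSemialgebraic_icoBox (1 : MvPolynomial (Fin 1) ℚ)).congr
      (fun x _ => by simp)
  integrableOn :=
    (continuous_const.continuousOn.integrableOn_compact isCompact_Icc).mono_set icoBox_subset_Icc

theorem value_icoRep : icoRep.value = 1 := by
  rw [KZ.IntegralRep.value]
  show ∫ _ in {y : Fin 1 → ℝ | y 0 ∈ Ico (0:ℝ) 1}, (1:ℝ) = 1
  have hpi : {y : Fin 1 → ℝ | y 0 ∈ Ico (0:ℝ) 1} = Set.pi univ (fun _ : Fin 1 => Ico (0:ℝ) 1) := by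
    ext y
    simp [Fin.forall_fin_one]
  rw [setIntegral_const, smul_eq_mul, mul_one, hpi, measureReal_def, volume_pi_pi]
  simp

theorem image_coordPow_two_symmBox :
    (fun x : Fin 1 → ℝ => BoxIntegral.coordPow 2 x) '' ibox 1 (-1) 1 = {y : Fin 1 → ℝ | y 0 ∈ Ico (0:ℝ) 1} := by
  ext y
  simp only [mem_image, mem_setOf_eq, mem_Ico]
  constructor
  · rintro ⟨x, hx, rfl⟩
    have h1 := (hx 0).1
    have h2 := (hx 0).2
    push_cast at h1 h2
    simp only [BoxIntegral.coordPow_apply]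
    constructor
    · positivity
    · nlinarith
  · rintro ⟨hy0, hy1⟩
    refine ⟨fun _ => Real.sqrt (y 0), fun i => ⟨?_, ?_⟩, ?_⟩
    · push_cast
      have := Real.sqrt_nonneg (y 0)
      linarith
    · push_cast
      rw [Real.sqrt_lt' one_pos]
      simpa using hy1
    · funext i
      fin_cases i
      simp [BoxIntegral.coordPow, Real.sq_sqrt hy0]

/-- `stub_orthantCoordPowMove` with the orthant hypothesis `r.domain ⊆ (0,∞)ⁿ` dropped. -/
def Stub2WithoutOrthant : Prop :=
  ∀ (n m : ℕ), 1 ≤ m → ∀ (r r' : KZ.IntegralRep n),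
    IsSemialgebraicMapOn ℚ r.domain (fun x : Fin n → ℝ => BoxIntegral.coordPow m x) →
    r'.domain = (fun x : Fin n → ℝ => BoxIntegral.coordPow m x) '' r.domain →
    (∀ x ∈ r.domain, r.integrand x = r'.integrand (BoxIntegral.coordPow m x) * ((m : ℝ) ^ n * ∏ i, x i ^ (m - 1))) →
    KZ.of r - KZ.of r' ∈ KZ.changeOfVariablesRel

/-- The orthant hypothesis is load-bearing (for even `m`): `m = 2`, `n = 1`, source `[(-1,1), 2t]`,
target `[[0,1), 1]` (`[0,1) = Φ₂''(-1,1)` exactly); values `0 ≠ 1`. -/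
theorem stub2_false_without_orthant : ¬ Stub2WithoutOrthant := by
  intro h
  have hmem := h 1 2 (by norm_num) (monoRep (-1) 1 2 1) icoRep
    (stub1_holds 1 2 _ (monoRep (-1) 1 2 1).isSemialgebraic_domain)
    (by rw [monoRep_domain, image_coordPow_two_symmBox]; rfl)
    (fun x _ => by simp [icoRep])
  have hv := value_eq_of_mem hmem
  rw [value_monoRep _ _ _ _ (by norm_num), integral_pow, value_icoRep] at hv
  norm_num at hv

/-- `stub_orthantCoordPowMove` with the image clause `r'.domain = Φ '' r.domain` dropped. -/
def Stub2WithoutImage : Prop :=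
  ∀ (n m : ℕ), 1 ≤ m → ∀ (r r' : KZ.IntegralRep n), r.domain ⊆ {x | ∀ i, 0 < x i} →
    IsSemialgebraicMapOn ℚ r.domain (fun x : Fin n → ℝ => BoxIntegral.coordPow m x) →
    (∀ x ∈ r.domain, r.integrand x = r'.integrand (BoxIntegral.coordPow m x) * ((m : ℝ) ^ n * ∏ i, x i ^ (m - 1))) →
    KZ.of r - KZ.of r' ∈ KZ.changeOfVariablesRel

/-- The image clause is load-bearing: reduces to the landed `not_dilationMoveBoxes_target`
(m = 1, source `(0,1)`, target `(0,2)`, integrands `1`: values `1 ≠ 2`). -/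
theorem stub2_false_without_image : ¬ Stub2WithoutImage := fun h =>
  not_dilationMoveBoxes_target fun r r' hr _ hint =>
    h 1 1 le_rfl r r' (by rw [hr]; exact fun x hx i => by simpa using (hx i).1)
      (stub1_holds 1 1 _ r.isSemialgebraic_domain)
      (fun x hx => hint x hx)

/-- `stub_orthantCoordPowMove` with the Jacobian factor dropped from the integrand relation. -/
def Stub2WithoutJacobian : Prop :=
  ∀ (n m : ℕ), 1 ≤ m → ∀ (r r' : KZ.IntegralRep n), r.domain ⊆ {x | ∀ i, 0 < x i} →
    IsSemialgebraicMapOn ℚ r.domain (fun x : Fin n → ℝ => BoxIntegral.coordPow m x) →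
    r'.domain = (fun x : Fin n → ℝ => BoxIntegral.coordPow m x) '' r.domain →
    (∀ x ∈ r.domain, r.integrand x = r'.integrand (BoxIntegral.coordPow m x)) →
    KZ.of r - KZ.of r' ∈ KZ.changeOfVariablesRel

/-- The Jacobian factor is load-bearing: reduces to the landed `not_dilationMoveJac_noJacobian`
(m = 2 on the unit box, `r = [(0,1), t²]`, `r' = [(0,1), t]`: values `1/3 ≠ 1/2`). -/
theorem stub2_false_without_jacobian : ¬ Stub2WithoutJacobian := fun h =>
  not_dilationMoveJac_noJacobian fun r r' hr hr' hint =>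
    h 1 2 (by norm_num) r r' (by rw [hr]; exact fun x hx i => (hx i).1)
      (stub1_holds 1 2 _ r.isSemialgebraic_domain)
      (by rw [hr', hr]; exact (BoxIntegral.image_coordPow_box two_ne_zero).symm)
      (fun x hx => by rw [hint x hx]; show _ = r'.integrand (fun i => x i ^ 2); simp)

/-! ## §4 positive strengthenings (information only) -/

/-- the `IsSemialgebraicMapOn` hypothesis of stub 2 is redundant (it is stub 1). -/
theorem stub2_without_semialgHyp (n m : ℕ) (hm : 1 ≤ m) (r r' : KZ.IntegralRep n)
    (hσ : r.domain ⊆ {x | ∀ i, 0 < x i})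
    (himg : r'.domain = (fun x : Fin n → ℝ => BoxIntegral.coordPow m x) '' r.domain)
    (hint : ∀ x ∈ r.domain, r.integrand x = r'.integrand (BoxIntegral.coordPow m x) * ((m : ℝ) ^ n * ∏ i, x i ^ (m - 1))) :
    KZ.of r - KZ.of r' ∈ KZ.changeOfVariablesRel :=
  stub2_holds n m hm r r' hσ (stub1_holds n m _ r.isSemialgebraic_domain) himg hint

/-- for ODD `m` the orthant hypothesis (and `1 ≤ m`) can be dropped: `t ↦ t^m` is injective on `ℝ`
and `mⁿ ∏ xᵢ^(m-1) ≥ 0` everywhere (`m - 1` even), so `|det| = det`-as-printed on ANY domain. -/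
theorem stub2_odd_anyDomain (n m : ℕ) (hm : Odd m) (r r' : KZ.IntegralRep n)
    (himg : r'.domain = (fun x : Fin n → ℝ => BoxIntegral.coordPow m x) '' r.domain)
    (hint : ∀ x ∈ r.domain, r.integrand x = r'.integrand (BoxIntegral.coordPow m x) * ((m : ℝ) ^ n * ∏ i, x i ^ (m - 1))) :
    KZ.of r - KZ.of r' ∈ KZ.changeOfVariablesRel := by
  refine ⟨n, r, r', fun x => BoxIntegral.coordPow m x, BoxIntegral.coordPowDeriv m,
    stub1_holds n m _ r.isSemialgebraic_domain,
    fun x _ => BoxIntegral.hasFDerivWithinAt_coordPow m r.domain x, ?_, himg, fun x hx => ?_, rfl⟩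
  · intro x _ y _ hxy
    funext i
    exact hm.strictMono_pow.injective (congr_fun hxy i)
  · rw [hint x hx, BoxIntegral.det_coordPowDeriv, abs_of_nonneg]
    exact mul_nonneg (pow_nonneg (Nat.cast_nonneg _) _)
      (Finset.prod_nonneg fun i _ => (Nat.Odd.sub_odd hm odd_one).pow_nonneg _)

end DrefuteStubs
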